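import Summits.QuantumFields.YangMills.Theorems.UnitScaleTiltProp7StubEXOfChartPiecesTwS55
import Summits.QuantumFields.YangMills.Theorems.UnitScaleTiltRungOfExistenceMinimalOrbitV4
import HarnessLib

/-!
# Rung R3 (cell `ym3-torus`) — **THE «RUNG FACE» ON THE EX DISPLAY OF RECORD S55 (✓p782987): A CONDITIONAL THEOREM WITH 11 OPEN HYPOTHESES.  IT DOES NOT PROVE `YM3TorusSU2`.** (★★OWNER g31 RULING №29;
# the №29 pair is regenerated once per EX display event by the routeR-w1 lineage — not seated since g13; this edition by width seat `ym3-torus-px16 g16` with routeR-w1 g13's `gen/gen_rung_xs.py` run VERBATIM on the TREE display)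
# `YM3TorusSU2` (continuum SU(2) Yang–Mills on every three-torus; the route leaf of `UnitScaleTilt`) BY NAME from EXACTLY: the 9 rows of the EX display of record (S55) of crux K1 `MinimiserStabilityRegPr`
# (stmt-QuantumFields-19200) ∧ the deciding crux decl `FluctuationComparisonRegPrIntL` (stmt-QuantumFields-20520, `h201`) ∧ the ONE row `hrows` = NODE O's Sel∕Xs v4 data-rows display (O‴χₛ) through which
# ★★OWNER RECORD 17bl's «R3 DAG OF RECORD AS ONE KERNEL NAME» ✓p758552 `UnitScaleTiltRungOfExistenceMinimalOrbitV4.ym3TorusSU2_of_existenceMinimalOrbit_regPrIntL_selXsV4DataRows (hEX) (h201) (hrows)` reads the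
# K2 crux `HistoryTailL` (19936 registry v6 = {EX, (O‴χₛ)}) — and NOTHING ELSE.
# HONEST BLOCK (RULING №29 (iv)): at S55 the EX display carries ZERO [Balaban1985BackgroundPropagators] §3 ∕ [Balaban1985Variational] Prop. 7 print rows (all discharged by kernel inside the chain, RECORDs 17bs–17ea);
# its rows are the parameter∕window letters `αcap hαcap c₀ cB a ha A₁ hA₁` and the analytic letter `hThm2S3`:
# 
# `hThm2S3` = [Balaban1985RegularSpaces] THEOREM 2 at the `SU(2)` Setup-torus objects of the members of the block-size-THREE families ONLY (`∃ B₁ c₁ > 0, ∀ F, F.L = 3 → ∀ n < K, ∃ β₀ B₂ len, B8Thm2SetupTorus.Thm2SetupSUAt (F.P K) 2 (K − n) (eta F n K) β₀ B₁ B₂ c₁ len (fun _ => True)`) — the display's former letter `hThm2S` (all L > 1) REDUCED by ★p1 g29 ✓`Prop7Thm2SocketOfCoverForm.hThm2S_of_three`: for EVERY L ≥ 5 Theorem 2 is a HYPOTHESIS-FREE tree theorem ✓`hThm2S_body_of_five_le` (lit-balaban's binder-free EIGHTH cover form ✓p720401 `B8Thm2TorusCoverOfProp6DeltaA.hThm2Cover_of_prop6_deltaA`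 + ym-inputs ✓`N16Thm2TorusOfCover.thm2TorusAt_of_dvd'` descent by uniqueness; axioms trio re-run from two slots), even L have no `T3Family` member; the L = 3 class is the located residue LF-1EX (`4 ≤ ℓ` in the cover chain) — a PRINT CLAIM displayed as a hypothesis, supplier = lit-balaban's L = 3 re-edition of the cover chain OR a post-freeze re-cut of the crux to L ≥ 5 (planner∕director).
# 20520 is an OPEN crux with its own registered line (`h201` displayed BY NAME); `hrows` is NODE O's (O‴χₛ) Sel∕Xs data-rows display (per odd `L > 1`: thresholds, `Thm1GlobalMinAt`, the `AlphaConsts` record with its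
# C68∕window inequalities, `SmallFactor71OfRecT3`, and `TrivMinimiserRowsT3 → DataRowsT3XsChiSel`) — DISPLAYED, not proved ([Balaban1985UV3] (5) p.256, (47) p.267, (67)–(71) p.273; (α) data rows 0∕23 of registry v6).
# «R3 ⟸ exactly these, in one kernel sentence» is the point of this object and also its honest limit.  Every hypothesis is exactly as open as before.
# NOT a display (the EX display and ✓p758552 stay the displays of record; no row changed) · NOT a registry event (helper filing; no `@[closes]`, no binder, no skeleton ∕ birth_v10 ∕ J-r4 edit; J-FREEZE honoured;
# the route file is reached only via ✓p758552's imports — the known `lint.theses-cone` advisory class of ✓p744243∕✓p758552∕✓p759771) · CREDITS NOTHING.  Rung R3 itself is a record rung: NOT d = 4, NOT infinite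
# volume, NOT a mass gap, NOT the Clay problem; the YM mass gap is not addressed here.

THEOREMS ONLY (0 `def`, 0 `sorry`, 0 `instance`); a decl-local `maxHeartbeats 400000` on each of the two theorems (README №24 class); `--supports stmt-QuantumFields-19200 --as helper`, count-neutral.
HOW: proof = ✓p758552 applied at `hEX := stubEX_of_chartPiecesTwS55 ⟨the 9 EX rows⟩`, `h201`, `hrows`; imports = the EX display + ✓p758552 + HarnessLib.  Binders = the EX display's VERBATIM + `h201` +
the `hrows` binder of ✓p758552 VERBATIM (both generated by script from the tree files, comments included); conclusion = the rung decl by name; proof = one `exact`.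
§2 (chair ★p1 g29 WORD №70): the INSTANTIATED corollary `ym3TorusSU2_of_thm2SS55Xs` — every EX parameter∕window letter chosen INSIDE the proof; displayed = the analytic letter(s) + `h201` + `hrows`.
References: T. Bałaban, CMP 102 (1985) 277–309 [Balaban1985Variational]; CMP 99 (1985) 389–434 [Balaban1985BackgroundPropagators] (§3); CMP 99 (1985) 75–102 [Balaban1985RegularSpaces] (Thm 2 p.83);
CMP 102 (1985) 255–275 [Balaban1985UV3] (Thm 1 (5) p.256, (41) p.266, (47) p.267, (67), (70)–(71) p.273); C. King, CMP 102 (1986) 649–677 [King1986] (Thm 3.4).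
-/

set_option autoImplicit false

noncomputable section

open scoped BigOperators Matrix.Norms.L2Operator Matrix InnerProductSpace

namespace Summit.QuantumFields.YangMills.Theorems.YM3TorusSU2OfFacesS55Xs

open NormedSpace
open Literature.Analysis.Calculus.ExpDifferential (ad gSer)
open Literature.MathematicalPhysics.QuantumFieldTheory.Balaban1983to89
open Literature.MathematicalPhysics.QuantumFieldTheory.Balaban1983to89.T3ContinuumYM3Torus
open Literature.MathematicalPhysics.QuantumFieldTheory.Balaban1983to89.T3UnitLawDensityEML (ℰp)
open Literature.MathematicalPhysics.QuantumFieldTheory.Balaban1983to89.T3TiltDescent (descendTo)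
open Literature.MathematicalPhysics.QuantumFieldTheory.Balaban1983to89.T3ConstrainedMinimiser (fibre)
open Literature.MathematicalPhysics.QuantumFieldTheory.Balaban1983to89.T3PrintedRegularMinimiser (RegPr regFibrePr)
open Literature.MathematicalPhysics.QuantumFieldTheory.Balaban1983to89.T3Thm1Carrier
open Literature.MathematicalPhysics.QuantumFieldTheory.Balaban1983to89.T3SectALandauChart (In19 emb15 CloseAvg eta bgUnits pert)
open B9SectCLatticeCarrier (Bond)
open B9Eq311L2Pairing (WL2)
open B10Eq27TorusAxialLog (unitsField toUField pull transl holT)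
open B11Eq115Space (NegSup NegSize Space115 JetSup levWeight)
open B11Eq111FrakG (nabla115)
open B11Eq98CurrentSlot (Jcur)
open B11Eq103H1Complex (BondL2K funEquiv SiteL2K laplaceAK)
open B11Prop3Model (Dfix)
open B13Contraction113 (QuadAnalytic)
open B8Thm2SetupTorus (Thm2SetupSUAt)
open MatrixLog (mlog)
open Summit.QuantumFields.YangMills.Theorems.Prop7TPrint (nMax19 expHermField)
open Summit.QuantumFields.YangMills.Theorems.Prop7SPrint (NormS IsLandauPrintS basePt RestrictedPrint isLandauPrintS_iff_RS AvgCondPrint IsLandauPrint)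
open Summit.QuantumFields.YangMills.Theorems.Prop7SectET3Transport (periodsT3 bgOfCfg bondEquiv)
open Summit.QuantumFields.YangMills.Theorems.Prop7SectET3HilbertLetters (W₂ toL2 toL2B DL2 DstarL2 frobEquiv covLapSite toL2S)
open Summit.QuantumFields.YangMills.Theorems.Prop7SectET3GaugeProjector (RS)
open Summit.QuantumFields.YangMills.Theorems.Prop7SymAvgTwSym (QTwS CmapTwS Chart47T3twS)
open Summit.QuantumFields.YangMills.Theorems.Prop7SymAvgGL (QSym descendToGL)
open Summit.QuantumFields.YangMills.Theorems.Prop7SectET3CurvedPropagators (laplaceA PosOnto frakGfR H1f QTwS_Hf Qk GT KinvT)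
open Summit.QuantumFields.YangMills.Theorems.Prop7SectET3DeltaPiPInv (DeltaPiSlotP H46P inner_DL2_DeltaPiP_eq_zero GprimeP)
open Summit.QuantumFields.YangMills.Theorems.Prop7SectET3DeltaOnePInv (DeltaOnePJ TJSlotP DeltaOneP_kills_NS inner_DL2_DeltaOneP_eq_zero)
open Summit.QuantumFields.YangMills.Theorems.Prop7HDsolAtRecordOfRowsTwoSlotFamilyLLift (hΔsol_of_opRows_twoSlot_familyL)
open Summit.QuantumFields.YangMills.Theorems.Prop7HWROfRowsFamily (hWR_of_rows_family)
open Summit.QuantumFields.YangMills.Theorems.Prop7Prop4OfW80RowsAtRecord (prop4_W80_family)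
open Summit.QuantumFields.YangMills.Theorems.Prop7DeltaEtaHfCompositeNorm (hN₁_family_of_rows)
open Summit.QuantumFields.YangMills.Theorems.Prop7RieszTauFrobNorm (opNorm_rieszτ_frobEquiv_le_one opNorm_trace_clm_le_two hqV_record_family)
open Summit.QuantumFields.YangMills.Theorems.Prop7V0CurrentReality (hV0_of_RC_family)
open Summit.QuantumFields.YangMills.Theorems.Prop7ThetaOfColumnLettersT3 (theta_rows_family_of_columnLetters)
open Summit.QuantumFields.YangMills.Theorems.Prop7RCOfRowsFamily (hRC_of_rows_family_B₀)
open Summit.QuantumFields.YangMills.Theorems.Prop7RealityRowsFamily (hHfR_family hH₁R_family h𝒢R_family)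
open B11Eq63V0GroupCurrent (curV0)
open B11Eq80Current (Emap E3 W80)
open B11Eq90Transpose (kernel single115)
open B11Eq90V0primeCurrent (flat115)
open B11Eq174Chart (Regime)
open B11Eq90V0GroupComposed (curV0full T47)
open Summit.QuantumFields.YangMills.Theorems.Prop7SectET3EXJunction (h102_of_posOnto h129_of_posOnto h45_of_posOnto h102LS_of_posOnto h129LS_of_posOnto)
open Summit.QuantumFields.YangMills.Theorems.Prop7H46GradRow (h46_rows_of_norm115)
open Summit.QuantumFields.YangMills.Theorems.Prop7QkOntoOfRegPr (surjective_Qk_of_regPr)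
open T3SectALandauChart (bgUnits covGradT covCodiffCurlT covLapFormT)

open Summit.QuantumFields.YangMills.Theorems.Prop7SectET3WilsonHessian (DeltaEta DeltaEtaSlot)
open Summit.QuantumFields.YangMills.Theorems.Prop7H46TwoOfOpRowsFamily (hBH₂_of_nonneg)
open Summit.QuantumFields.YangMills.Theorems.Prop7HDsolAtRecordOfRowsFamily (hMΔ_of_nonneg)
open Summit.QuantumFields.YangMills.Theorems.Prop7H46PTwoOfOpRowsFamily (h46₂P_of_opRows_family)

open B11Eq98V0primeCurrentSlots (rieszτ)
open B9Eq3119DeltaPiCarrier (currentCLM)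
open Summit.QuantumFields.YangMills.Theorems.Prop7ColumnRowsOfKernelDecay (hHcol_of_kernel133_family hΔHcol_of_kernel88_family thetaH_nonneg thetaΔ_nonneg)
open Summit.QuantumFields.YangMills.Theorems.Prop7Op349OfKernelRow (hOp349_of_kernel349_family k349_nonneg)
open Summit.QuantumFields.YangMills.Theorems.Prop7PA2OfSymDiffDivRows (hPA2_of_symL1_diffL1_divSlice)
open Summit.QuantumFields.YangMills.Theorems.Prop7DivSliceRowHolds (hV_holds)
open Summit.QuantumFields.YangMills.Theorems.Prop7HcoSOfNormG0DiffRow (hS_holds)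
open Summit.QuantumFields.YangMills.Theorems.Prop7StubEXOfChartPiecesTwS25LLift (stubEX_of_chartPiecesTwS25L)
open Summit.QuantumFields.YangMills.Theorems.Prop7Op139OfGaugeColumnLift (hOp139π_of_gaugeColumn_family)
open Summit.QuantumFields.YangMills.Theorems.Prop7Op139OfGaugeColumn (k139_nonneg)
open Summit.QuantumFields.YangMills.Theorems.Prop7DivRecoveryPatchRows (patch_rows)
open Summit.QuantumFields.YangMills.Theorems.Prop7QH1DoorHolds (hQH1_doorH_holds)
open Summit.QuantumFields.YangMills.Theorems.Prop7HN06OfPatch (hN06_of_patchRows)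
open Summit.QuantumFields.YangMills.Theorems.Prop7CombHMc2Holds (hMc₂_holds)
open Summit.QuantumFields.YangMills.Theorems.Prop7N32SymRow (hN2s_holds)
open Summit.QuantumFields.YangMills.Theorems.Prop7CombHMcombHolds (hMcomb_holds)
open Literature.MathematicalPhysics.QuantumLattice (blockBase)
open T3LevelShift (bondShift siteShift)
open B7Eq78Linearization (conjR)
open B7Prop1Explicit (U1 expUnit)
open T4TermwiseTorus (tlift)
open Summit.QuantumFields.YangMills.Theorems.Prop7QprimeCombL2 (RcombL2)
open B7Eq92Concrete (tildIter)
open BlockAveragingEMLLinearisedBackground (pertVar)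
open ExpMeanLog (expMeanLogSU)
open BlockAveraging (blockAvg)
open Summit.QuantumFields.YangMills.Theorems.Prop7CovKernel157Family (hC157_family)
open B9Eq39Adjoint (curl divB)
open B9TorusCalculus (torusT)
open Summit.QuantumFields.YangMills.Theorems.Prop7SectET3CombLetters (Qkc)
open Summit.QuantumFields.YangMills.Theorems.Prop7SymAvgTw (CmapTw)
open Summit.QuantumFields.YangMills.Theorems.Prop7CcolOf157Entry (hCcol_of_157_family hG0_of_hg0)
open Prop8Chart (emlIterU)
open B15DeterminingSets (embIter)
open Summit.QuantumFields.YangMills.Theorems.Prop7Op137OfKernelRows (h137π_of_kernel137_family h137Δ_of_kernel137_family hOpC_of_kernelC_family)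
open B5Eq118OneStroke (iterBlockOf)
open T3PrintedRegularOrbits (sites_eq)
open Summit.QuantumFields.YangMills.Theorems.Prop7CmapTwSupRow (hcoS_of_normG0_of_combRemainderL1Rows)
open Summit.QuantumFields.YangMills.Theorems.Prop7HDOfCombRows (hD_of_hMcomb)
open Summit.QuantumFields.YangMills.Theorems.Prop7IrrLiftRowOfRecord (hIrrLift_of_record)
open Summit.QuantumFields.YangMills.Theorems.Prop7EXNumeralRowsInhabited (ex_numeral_rows_inhabited)

open Summit.QuantumFields.YangMills.Theorems.Prop7StubEXOfChartPiecesTwS43LT2 (stubEX_of_chartPiecesTwS43LT2)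
open Summit.QuantumFields.YangMills.Theorems.Prop7PositivityBlockDoorLiftedRows (positivityRows_lift_of_liftedRows)
open Summit.QuantumFields.YangMills.Theorems.Prop7TJRowOfEntry157Lift (hTJ_of_hHcol_h157)
open Summit.QuantumFields.YangMills.Theorems.Prop7ColumnRowsOfKernelDecayLift (hHcol_of_kernel133_family)

open Summit.QuantumFields.YangMills.Theorems.Prop7StubEXOfChartPiecesTwS44LG (stubEX_of_chartPiecesTwS44LG)
open Summit.QuantumFields.YangMills.Theorems.Prop7GaugeFixedRowDoorOfLODTarget (gaugeFixedRow_idx_of_curvedTarget_of_le_coupling)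
open T3PrintedMinimiserExistence (regPr_mono)
open B7TransferAnalyticMean (meanCLM)
open B11Eq103H1Complex (projR)
open Summit.QuantumFields.YangMills.Theorems.Prop7SectET3GaugeProjector (NS)
open B7Prop1Explicit (disp)
open T4Continuum BlockAveraging

open Summit.QuantumFields.YangMills.Theorems.Prop7StubEXOfChartPiecesTwS45 (stubEX_of_chartPiecesTwS45)
open Summit.QuantumFields.YangMills.Theorems.Prop7KernelRow349DoorOfLODTarget (kernelRow349_idx_of_projRTarget)
open T3PrintedMinimiserExistence (regPr_mono)
open B7TransferAnalyticMean (meanCLM)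
open B11Eq103H1Complex (projR)
open Summit.QuantumFields.YangMills.Theorems.Prop7SectET3GaugeProjector (NS)
open B7Prop1Explicit (disp)
open T4Continuum BlockAveraging

open Summit.QuantumFields.YangMills.Theorems.Prop7StubEXOfChartPiecesTwS46 (stubEX_of_chartPiecesTwS46)
open T3PrintedMinimiserExistence (regPr_mono)
open B7TransferAnalyticMean (meanCLM)
open B11Eq103H1Complex (projR)
open Summit.QuantumFields.YangMills.Theorems.Prop7SectET3GaugeProjector (NS)
open B7Prop1Explicit (disp)
open T4Continuum BlockAveraging
open Summit.QuantumFields.YangMills.Theorems.Prop7StubEXOfChartPiecesTwS47 (stubEX_of_chartPiecesTwS47)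
open Summit.QuantumFields.YangMills.Theorems.Prop7H133FamilyPackageAllMembers (h133_family_exists_allMembers h137kpi_family_exists_allMembers)
open T3PrintedMinimiserExistence (regPr_mono)
open Summit.QuantumFields.YangMills.Theorems.Prop7StubEXOfChartPiecesTwS48 (stubEX_of_chartPiecesTwS48)
open Summit.QuantumFields.YangMills.Theorems.Prop7NormHpiFamilyPackageAllMembers (normHpi_family_exists_allMembers)
open Summit.QuantumFields.YangMills.Theorems.Prop7H88FamilyPackageAllMembers (h88_family_exists_allMembers)
open Summit.QuantumFields.YangMills.Theorems.Prop7KRows78EtaTJFamilyPackageAllMembers (hCk_family_exists_allMembers)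
open Summit.QuantumFields.YangMills.Theorems.Prop7KRows78EtaTJFamilyPackageAllMembers (h137kDelta_family_exists_allMembers)
open T3PrintedMinimiserExistence (regPr_mono)
open Summit.QuantumFields.YangMills.Theorems.Prop7StubEXOfChartPiecesTwS49 (stubEX_of_chartPiecesTwS49)
open Summit.QuantumFields.YangMills.Theorems.Prop7NormHoneFamilyPackageAllMembers (normHone_family_exists_allMembers)
open Summit.QuantumFields.YangMills.Theorems.Prop7SectET3DeltaOne (avgHess)
open T3PrintedMinimiserExistence (regPr_mono)
open Summit.QuantumFields.YangMills.Theorems.Prop7StubEXOfChartPiecesTwS50 (stubEX_of_chartPiecesTwS50)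
open Summit.QuantumFields.YangMills.Theorems.Prop7NormGFamilyPackageAllMembers (normG_family_exists_allMembers)
open Summit.QuantumFields.YangMills.Theorems.Prop7SectET3DeltaOnePInv (DeltaOneP)
open T3PrintedMinimiserExistence (regPr_mono)
open Summit.QuantumFields.YangMills.Theorems.Prop7StubEXOfChartPiecesTwS51 (stubEX_of_chartPiecesTwS51)
open Summit.QuantumFields.YangMills.Theorems.Prop7StoreyHGradientFamily (h3_family_exists)
open B10Eq27TorusAxialLog (axialT)
open B4Sect5Torus (TSite tdist)
open Summit.QuantumFields.YangMills.Theorems.Prop7SectET3Transport (siteEquiv)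
open Summit.QuantumFields.YangMills.Theorems.CoverSites
open Summit.QuantumFields.YangMills.Theorems.Prop7StubEXOfChartPiecesTwS52 (stubEX_of_chartPiecesTwS52)
open Summit.QuantumFields.YangMills.Theorems.Prop7AvgHessGaugeHqGClosed (hqG_family_closed qG_family_closed_nonneg)
open Summit.QuantumFields.YangMills.Theorems.Prop7StubEXOfChartPiecesTwS53 (stubEX_of_chartPiecesTwS53)
open Summit.QuantumFields.YangMills.Theorems.Prop7Thm2SocketOfCoverForm (hThm2S_of_three)
open B8Thm2SetupTorus (Thm2SetupSUAt)
open Summit.QuantumFields.YangMills.Theorems.Prop7StubEXOfChartPiecesTwS54 (stubEX_of_chartPiecesTwS54)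
open Summit.QuantumFields.YangMills.Theorems.Prop7OmegaOneAxialHolderFamily (hHωw_family_exists)
open Summit.QuantumFields.YangMills.Theorems.Prop7StubEXOfChartPiecesTwS55 (stubEX_of_chartPiecesTwS55)
-- opens of the K2 face of record (✓p758552), for its binders
open MeasureTheory Set
open Literature.MathematicalPhysics.QuantumFieldTheory.Balaban1983to89
open Literature.MathematicalPhysics.QuantumFieldTheory.Balaban1983to89.T3ContinuumYM3Torus
open Literature.MathematicalPhysics.QuantumFieldTheory.Balaban1983to89.T3UnitLawDensityEML (ℰp)
open Literature.MathematicalPhysics.QuantumFieldTheory.Balaban1983to89.T3PrintedRegularMinimiser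
open Literature.MathematicalPhysics.QuantumFieldTheory.Balaban1983to89.T3PrintedMinimiserExistence
open Literature.MathematicalPhysics.QuantumFieldTheory.Balaban1983to89.T3ConstrainedMinimiser (fibre)
open Literature.MathematicalPhysics.QuantumFieldTheory.Balaban1983to89.T3LowerAlongMinimisersSplit (MinimisersIn8At)
open Literature.MathematicalPhysics.QuantumFieldTheory.Balaban1983to89.T3Thm1Carrier (famX Idx)
open Literature.MathematicalPhysics.QuantumFieldTheory.Balaban1983to89.ExpMeanLog (deltaSU)
open Literature.MathematicalPhysics.QuantumFieldTheory.Balaban1985CMP102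
open Literature.MathematicalPhysics.QuantumFieldTheory.Balaban1985CMP102.Setting
open Summit.QuantumFields.Balaban3D.Carriers
open Summit.QuantumFields.Balaban3D.Proofs.Primitives
open Summit.QuantumFields.Balaban3D.Proofs.Thresholds (Q0)
open Literature.MathematicalPhysics.QuantumFieldTheory.Balaban1983to89.B7Prop2Explicit (C0)
open Summit.QuantumFields.YangMills.Theorems.AttainmentOfExistence (MinimiserStabilityRegPr_of_halvingStep_of_existence)
open Summit.QuantumFields.YangMills.Theorems.MinimiserStabilityRegPrStubHalvingStep (stub_halvingStep)
open Summit.QuantumFields.YangMills.Theorems.HistoryTailOfExistenceMinimalOrbit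
open Summit.QuantumFields.YangMills.Theorems.RungOfExistenceMinimalOrbit (ym3TorusSU2_of_existenceMinimalOrbit_regPrIntL_selXsV4DataRows)

set_option maxHeartbeats 400000 in
-- hb: the statement carries the full EX face (9 binders) + `h201` + `hrows`; the one `exact` instantiates ✓p758552 at the EX display by name — same class as the S-displays (README №24).
/-- ★★★ **THE RUNG FACE — CONDITIONAL, 11 OPEN HYPOTHESES; DOES NOT PROVE `YM3TorusSU2`.**  Hypotheses = the 9 EX rows of S55 VERBATIM (ZERO print rows — all discharged by kernel inside the display chain; parameter∕window letters +
the ONE analytic letter = the Thm-2 socket `hThm2S`), the deciding crux decl `FluctuationComparisonRegPrIntL` (20520, open), the ONE (O‴χₛ) row `hrows` of ✓p758552 VERBATIM (NODE O Sel∕Xs v4 data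
rows — displayed, not proved); conclusion = the route leaf `T3YM3TorusStatement.YM3TorusSU2` BY NAME; proof = `ym3TorusSU2_of_existenceMinimalOrbit_regPrIntL_selXsV4DataRows (stubEX_of_chartPiecesTwS55 …9 rows…) h201 hrows`
(✓p758552 = ★★OWNER RECORD 17bl's R3 DAG of record, read at print-row granularity).  Not a display flip; not a registry event; credits nothing; rung R3 is NOT d = 4, NOT infinite volume, NOT a mass gap, NOT Clay.
[cite: Balaban1985Variational, Thm 1 (6)-(10) pp.278-279, Prop. 7 p.299; Balaban1985BackgroundPropagators, Thm 3.11 p.416; Balaban1985RegularSpaces, Thm 2 p.83; Balaban1985UV3, Thm 1 (5) p.256, (41) p.266, (67), (70)-(71) p.273; King1986, Thm 3.4 (3.9) p.656] -/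
theorem ym3TorusSU2_of_facesS55Xs
    [hFL : ∀ F : T3Family, Fact (0 < (F.L : ℝ))]
    [hFη : ∀ (F : T3Family) (k : ℕ), Fact (0 < ((F.L : ℝ)⁻¹) ^ k)]
    -- (PRINT-SHAPE EVENT) the ONE regularity cap below which every print row is asked («for U₀ ∈ 𝔄(ρ), ρ ≤ αcap» — [B9] Thm 3.3∕3.11∕3.12 shape); the census letters `C₄ a₃ α r M εC ef ε′`
    -- (with `α ≤ αcap`) and ALL 23 numeral rows + their 6 signs are chosen INSIDE the proof by ✓`Prop7EXNumeralRowsInhabited.ex_numeral_rows_inhabited` (px19 g7 ∕ ★p1 g20 SIGNATURE-0)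
    (αcap : ℕ → ℝ) (hαcap : ∀ L : ℕ, 1 < L → 0 < αcap L)
    (c₀ cB : ℕ → ℝ)
    [hc₀ : ∀ L : ℕ, Fact (0 < c₀ L)]
    [hcB : ∀ L : ℕ, Fact (0 < cB L)]
    (a : ∀ L : ℕ, Idx L → ℝ)
    -- (S45, ★★OWNER WORD 63 shape (B)) the display's coupling `a` is FREE above the LOD line's coupling `a₀·(c₀∕cB)·(L^{K−n})³` (`a₀ := 1`): the ONE changed row
    (ha : ∀ (L : ℕ) (i : Idx L), (c₀ L / cB L) * ((i.1.1.L : ℝ) ^ (i.1.2.2 - i.1.2.1)) ^ 3 ≤ a L i)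
    -- (S48, ★★OWNER RECORD 17cz (b)) the ONE new display letter: the coupling's UPPER pin, so that the K-storey's two-sided coupling window `[1, max A₁ 1]·(c₀∕cB)·(L^{K−n})³` holds
    (A₁ : ℝ)
    (hA₁ : ∀ L : ℕ, 1 < L → ∀ i : Idx L, a L i ≤ A₁ * ((c₀ L / cB L) * ((i.1.1.L : ℝ) ^ (i.1.2.2 - i.1.2.1)) ^ 3))
    -- ([B8] Thm 2 letter, L = 3 INSTANCE ONLY — ★p1 g29 ✓`hThm2S_of_three`: for every block size L ≥ 5 the body of `hThm2S` is a TREE THEOREM via lit-balaban's binder-free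
    -- cover form ✓`B8Thm2TorusCoverOfProp6DeltaA.hThm2Cover_of_prop6_deltaA` (4 ≤ ℓ); even L carry no `T3Family` member; so only the L = 3 class stays displayed — text = the socket's `h3` VERBATIM)
    (hThm2S3 : ∃ B₁ c₁ : ℝ, 0 < B₁ ∧ 0 < c₁ ∧ ∀ (F : T3Family), F.L = 3 → ∀ (n K : ℕ), n < K →
      ∃ (β₀ B₂ : ℝ) (len : B7Prop1Explicit.Site (F.P K).d → ℝ),
        Thm2SetupSUAt (F.P K) 2 (K - n) (eta F n K) β₀ B₁ B₂ c₁ len (fun _ => True))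
    -- the DECIDING crux of the route (stmt-QuantumFields-20520), as its decl
    (h201 : Summit.QuantumFields.YangMills.Theses.UnitScaleTilt.FluctuationComparisonRegPrIntL)
    -- the (O‴χₛ) row of ✓p758552 `UnitScaleTiltRungOfExistenceMinimalOrbitV4.ym3TorusSU2_of_existenceMinimalOrbit_regPrIntL_selXsV4DataRows` VERBATIM (19936 registry v6 row 2 `stub_selXsV4DataRows`)
    (hrows : ∀ L : ℕ, Odd L → 1 < L → ∃ (B₀ A₀ A₁ : ℝ), 0 < A₀ ∧ 0 < A₁ ∧
      ∀ (B a₀ a₁ : ℝ), B₀ ≤ B → 1 ≤ 2 * B → 0 < a₀ → a₀ ≤ A₀ → 0 < a₁ → a₁ ≤ A₁ → B * a₁ ≤ a₀ →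
        (143 * ((((3 + 4 : ℕ) : ℝ)) ^ 2 / 4) ^ 2) * (2 * (B * a₁)) ≤ 1 / 3 →
        2 * (2 * (B * a₁)) ≤ 2 * deltaSU (Fin 2) / (((3 + 4) * L : ℕ) : ℝ) ^ 2 →
        Thm1GlobalMinAt L a₀ a₁ B →
        ∃ (b₁ p₁ : ℝ), ∀ (b₀ p₀ : ℝ), b₁ ≤ b₀ → p₁ ≤ p₀ →
          ∃ 𝔠 : AlphaConsts L (suGroupModel 2).N, 𝔠.b₀ = b₀ ∧ 𝔠.p₀ = p₀ ∧ 𝔠.B₃ = B ∧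
            4 * 𝔠.B₃ * (L : ℝ) ^ 2 * avgWindowFactor L ≤ 𝔠.C68 ∧
            Real.exp (𝔠.p₀ - 1) ≤ 3 * C0 3 * 𝔠.C68 * (𝔠.b₀ * Q0 𝔠.p₀) ∧
            (𝔠.b₀ * Q0 𝔠.p₀) * (2 * (L : ℝ) ^ 2 * avgWindowFactor L) ^ 2 ≤ 3 * C0 3 * 𝔠.C68 * a₁ ^ 2 ∧
            ∀ (F : T3Family) (hF : F.L = L),
              (∀ (γ : ℝ) (hγ : 0 < γ) (hγ1 : γ ≤ (min (hF ▸ 𝔠).gamma0 1) ^ 2) (K : ℕ),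
                AlphaInputsT3AC.SmallFactor71OfRecT3 F (hF ▸ 𝔠) γ hγ hγ1 K) ∧
              ∀ (γ : ℝ) (hγ : 0 < γ) (hγ1 : γ ≤ (min (hF ▸ 𝔠).gamma0 1) ^ 2) (K : ℕ),
                (∃ Ut : (k : ℕ) → GaugeField (F.P K) k (Matrix.specialUnitaryGroup (Fin 2) ℂ) →
                    GaugeField (F.P K) 0 (Matrix.specialUnitaryGroup (Fin 2) ℂ),
                  AlphaInputsT3AC.TrivMinimiserRowsT3 F (hF ▸ 𝔠) γ hγ hγ1 a₀ a₁ K Ut) →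
                ∃ Ut : (k : ℕ) → GaugeField (F.P K) k (Matrix.specialUnitaryGroup (Fin 2) ℂ) →
                    GaugeField (F.P K) 0 (Matrix.specialUnitaryGroup (Fin 2) ℂ),
                  AlphaInputsT3AC.TrivMinimiserRowsT3 F (hF ▸ 𝔠) γ hγ hγ1 a₀ a₁ K Ut ∧
                    AlphaInputsT3AC.DataRowsT3XsChiSel F (hF ▸ 𝔠) γ hγ hγ1 K Ut) :
    Literature.MathematicalPhysics.QuantumFieldTheory.Balaban1983to89.T3YM3TorusStatement.YM3TorusSU2 := by
  exact Summit.QuantumFields.YangMills.Theorems.RungOfExistenceMinimalOrbit.ym3TorusSU2_of_existenceMinimalOrbit_regPrIntL_selXsV4DataRows (stubEX_of_chartPiecesTwS55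
    αcap hαcap c₀ cB a ha A₁ hA₁ hThm2S3)
    h201 hrows

set_option maxHeartbeats 400000 in
-- hb: same class as the face above (one `exact` through the display by name).
/-- ★★★ **THE INSTANTIATED COROLLARY (chair ★p1 g29 WORD №70)** — the same closure with EVERY parameter∕window letter of the display CHOSEN INSIDE the proof (`hFL`∕`hFη` from `F.hL`,
`αcap := 1`, `c₀ = cB := 1`, `a L i := ((1 : ℝ) / 1)·(L^{K−n})³` so `ha := le_rfl`, `A₁ := 1`): what is DISPLAYED is exactly the analytic
letter(s) {`hThm2S3`, `h201`, `hrows`}.  READING: «rung R3 `YM3TorusSU2` BY NAME ⟸ exactly these» — i.e. modulo [Balaban1985RegularSpaces] Thm 2 AT BLOCK SIZE L = 3 ONLY (L ≥ 5: ✓`hThm2S_body_of_five_le`, hypothesis-free).  CONDITIONAL; credits nothing;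
not a display flip; not a registry event. [cite: Balaban1985RegularSpaces, Thm 2 p.83; Balaban1985Variational, Prop. 7 p.299; Balaban1985UV3, Thm 1 (5) p.256] -/
theorem ym3TorusSU2_of_thm2SS55Xs
    (hThm2S3 : ∃ B₁ c₁ : ℝ, 0 < B₁ ∧ 0 < c₁ ∧ ∀ (F : T3Family), F.L = 3 → ∀ (n K : ℕ), n < K →
      ∃ (β₀ B₂ : ℝ) (len : B7Prop1Explicit.Site (F.P K).d → ℝ),
        Thm2SetupSUAt (F.P K) 2 (K - n) (eta F n K) β₀ B₁ B₂ c₁ len (fun _ => True))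
    (h201 : Summit.QuantumFields.YangMills.Theses.UnitScaleTilt.FluctuationComparisonRegPrIntL)
    (hrows : ∀ L : ℕ, Odd L → 1 < L → ∃ (B₀ A₀ A₁ : ℝ), 0 < A₀ ∧ 0 < A₁ ∧
      ∀ (B a₀ a₁ : ℝ), B₀ ≤ B → 1 ≤ 2 * B → 0 < a₀ → a₀ ≤ A₀ → 0 < a₁ → a₁ ≤ A₁ → B * a₁ ≤ a₀ →
        (143 * ((((3 + 4 : ℕ) : ℝ)) ^ 2 / 4) ^ 2) * (2 * (B * a₁)) ≤ 1 / 3 →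
        2 * (2 * (B * a₁)) ≤ 2 * deltaSU (Fin 2) / (((3 + 4) * L : ℕ) : ℝ) ^ 2 →
        Thm1GlobalMinAt L a₀ a₁ B →
        ∃ (b₁ p₁ : ℝ), ∀ (b₀ p₀ : ℝ), b₁ ≤ b₀ → p₁ ≤ p₀ →
          ∃ 𝔠 : AlphaConsts L (suGroupModel 2).N, 𝔠.b₀ = b₀ ∧ 𝔠.p₀ = p₀ ∧ 𝔠.B₃ = B ∧
            4 * 𝔠.B₃ * (L : ℝ) ^ 2 * avgWindowFactor L ≤ 𝔠.C68 ∧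
            Real.exp (𝔠.p₀ - 1) ≤ 3 * C0 3 * 𝔠.C68 * (𝔠.b₀ * Q0 𝔠.p₀) ∧
            (𝔠.b₀ * Q0 𝔠.p₀) * (2 * (L : ℝ) ^ 2 * avgWindowFactor L) ^ 2 ≤ 3 * C0 3 * 𝔠.C68 * a₁ ^ 2 ∧
            ∀ (F : T3Family) (hF : F.L = L),
              (∀ (γ : ℝ) (hγ : 0 < γ) (hγ1 : γ ≤ (min (hF ▸ 𝔠).gamma0 1) ^ 2) (K : ℕ),
                AlphaInputsT3AC.SmallFactor71OfRecT3 F (hF ▸ 𝔠) γ hγ hγ1 K) ∧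
              ∀ (γ : ℝ) (hγ : 0 < γ) (hγ1 : γ ≤ (min (hF ▸ 𝔠).gamma0 1) ^ 2) (K : ℕ),
                (∃ Ut : (k : ℕ) → GaugeField (F.P K) k (Matrix.specialUnitaryGroup (Fin 2) ℂ) →
                    GaugeField (F.P K) 0 (Matrix.specialUnitaryGroup (Fin 2) ℂ),
                  AlphaInputsT3AC.TrivMinimiserRowsT3 F (hF ▸ 𝔠) γ hγ hγ1 a₀ a₁ K Ut) →
                ∃ Ut : (k : ℕ) → GaugeField (F.P K) k (Matrix.specialUnitaryGroup (Fin 2) ℂ) →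
                    GaugeField (F.P K) 0 (Matrix.specialUnitaryGroup (Fin 2) ℂ),
                  AlphaInputsT3AC.TrivMinimiserRowsT3 F (hF ▸ 𝔠) γ hγ hγ1 a₀ a₁ K Ut ∧
                    AlphaInputsT3AC.DataRowsT3XsChiSel F (hF ▸ 𝔠) γ hγ hγ1 K Ut) :
    Literature.MathematicalPhysics.QuantumFieldTheory.Balaban1983to89.T3YM3TorusStatement.YM3TorusSU2 := by
  haveI hFL : ∀ F : T3Family, Fact (0 < (F.L : ℝ)) := fun F => ⟨by have h := F.hL.2; exact_mod_cast (lt_trans zero_lt_one h)⟩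
  haveI hFη : ∀ (F : T3Family) (k : ℕ), Fact (0 < ((F.L : ℝ)⁻¹) ^ k) := fun F k => ⟨pow_pos (inv_pos.mpr (hFL F).out) k⟩
  haveI hone : ∀ L : ℕ, Fact (0 < ((fun _ : ℕ => (1 : ℝ)) L)) := fun _ => ⟨one_pos⟩
  have hA₁' : ∀ L : ℕ, 1 < L → ∀ i : Idx L, (fun (L : ℕ) (i : Idx L) => ((1 : ℝ) / 1) * ((i.1.1.L : ℝ) ^ (i.1.2.2 - i.1.2.1)) ^ 3) L i ≤
      (1 : ℝ) * (((1 : ℝ) / 1) * ((i.1.1.L : ℝ) ^ (i.1.2.2 - i.1.2.1)) ^ 3) := fun L hL i => by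
    simp only [one_mul, le_refl]
  exact Summit.QuantumFields.YangMills.Theorems.RungOfExistenceMinimalOrbit.ym3TorusSU2_of_existenceMinimalOrbit_regPrIntL_selXsV4DataRows
    (stubEX_of_chartPiecesTwS55
      (fun _ => (1 : ℝ)) (fun L hL => one_pos) (fun _ => (1 : ℝ)) (fun _ => (1 : ℝ)) (fun (L : ℕ) (i : Idx L) => ((1 : ℝ) / 1) * ((i.1.1.L : ℝ) ^ (i.1.2.2 - i.1.2.1))
      ^ 3) (fun L i => le_rfl) (1 : ℝ) hA₁' hThm2S3) h201 hrows

end Summit.QuantumFields.YangMills.Theorems.YM3TorusSU2OfFacesS55Xs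

end
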